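import Literature.MathematicalPhysics.QuantumLattice.DWaveSourceNNNHoppingFlatTwistLocalDensity
import Literature.MathematicalPhysics.QuantumLattice.DWaveSourceNNNHoppingFlatTwistChordLimit
import HarnessLib

/-!
# The sourced helicity chord density has a thermodynamic limit along the trivial-holonomy sides (row T8)

Topic `Literature/MathematicalPhysics/QuantumLattice` (namespace = path; family `hubbard`). Sequel of
`DWaveSourceNNNHoppingFlatTwistLocalDensity.lean` (one local density periodises to the flat-twisted
pair-sourced torus; its energy density converges along all sides) and of hubbard-cq-p5's
`DWaveSourceNNNHoppingFlatTwistChord(Limit).lean` (the finite-volume chord bound). For a RATIONAL twist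
`q = 4πa/N` (`κ_i = χ_N(a_i)`; `q = 2π/4 ↔ N = 8`, `q = 2π/8 ↔ N = 16` for `a = (1,0)`):

* `tendsto_groundEnergy_dWaveSourceTorusTT'_div_sq_mul` — the untwisted sourced energy density along the
  sides `N(k+1)` (subsequence of the tree's `tendsto_dWaveSourceEnergyDensityTT'`);
* **`exists_tendsto_groundEnergy_dWaveSourceTorusTT'Twist_div_sq`** — the energy densities of the T8
  objects `dWaveSourceTorusTT'Twist (N(k+1)) t' U μ h (a·(k+1))` CONVERGE as `k → ∞` (to the all-sides
  limit of the uniformly twisted tori `dWaveSourceTorusTT'TwistU1`);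
* **`exists_tendsto_sourcedHelicityChord_div_sq`** — the SOURCED HELICITY CHORD DENSITY
  `ΔE_L(h,q)/L² = (E₀(dWaveSourceTorusTT'Twist L … ) − E₀(A_L(h)))/L²` converges along `L = N(k+1)` to some
  `c ≤ e_src(0) − e_src(h)`: the T8 word «`X ≤ ΔE(h,q)/L² ≤ Y`» reads on a thermodynamic-limit quantity,
  capped by the sourced gain.

HONEST SCOPE: existence of limits and the known cap; no number, no floor, no sign of `c`, nothing about
superconductivity; the sides with non-trivial holonomy are not covered. Everything PROVED; no definition,
no named fact.

## References
* H. Watanabe, J. Stat. Phys. 177 (2019) 717, §2.2.1. [cite: Watanabe2019, §2.2.1]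
* O. Bratteli, A. Kishimoto, D. W. Robinson, Commun. Math. Phys. 64 (1978) 41, Thm. 2.
  [cite: BratteliKishimotoRobinson1978, Thm. 2]
* T. Koma, H. Tasaki, J. Stat. Phys. 76 (1994) 745, §1. [cite: KomaTasaki1994, §1]
-/

noncomputable section

namespace Literature.MathematicalPhysics.QuantumLattice

open _root_.Matrix Finset Literature.Probability.LatticeModels

section Sequel

open _root_.Filter
open scoped _root_.Topology

/-- Transport of the twisted energy density along an equality of sides (the side enters the TYPE of the
torus). [folklore] -/
private theorem groundEnergy_twistU1_div_sq_congr {M M' : ℕ} [NeZero M] [NeZero M'] (hMM' : M = M')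
    (t' U μ h : ℝ) (κ : Fin 2 → Circle) :
    (dWaveSourceTorusTT'TwistU1 M t' U μ h κ).groundEnergy / ((M : ℕ) : ℝ) ^ 2 =
      (dWaveSourceTorusTT'TwistU1 M' t' U μ h κ).groundEnergy / ((M' : ℕ) : ℝ) ^ 2 := by
  subst hMM'
  rfl

/-- Transport of the sourced energy density along an equality of sides. [folklore] -/
private theorem groundEnergy_sourced_div_sq_congr {M M' : ℕ} [NeZero M] [NeZero M'] (hMM' : M = M')
    (t' U μ h : ℝ) :
    (dWaveSourceTorusTT' M t' U μ h).groundEnergy / ((M : ℕ) : ℝ) ^ 2 =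
      (dWaveSourceTorusTT' M' t' U μ h).groundEnergy / ((M' : ℕ) : ℝ) ^ 2 := by
  subst hMM'
  rfl

variable (N : ℕ) [NeZero N]

/-- The sides `N(k+1) − 1 → ∞`. [folklore] -/
private theorem tendsto_mul_succ_sub_one : Tendsto (fun k : ℕ => N * (k + 1) - 1) atTop atTop := by
  have hN : 0 < N := Nat.pos_of_ne_zero (NeZero.ne N)
  refine tendsto_atTop_mono (fun k => ?_) tendsto_id
  show k ≤ N * (k + 1) - 1
  have : k + 1 ≤ N * (k + 1) := Nat.le_mul_of_pos_left _ hN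
  omega

omit [NeZero N] in
/-- Side arithmetic: `(N(k+1) − 1) + 1 = N(k+1)` for `N ≥ 1`. [folklore] -/
private theorem mul_succ_sub_one_add_one (hN : 0 < N) (k : ℕ) : N * (k + 1) - 1 + 1 = N * (k + 1) := by
  have : k + 1 ≤ N * (k + 1) := Nat.le_mul_of_pos_left _ hN
  omega

/-- The untwisted sourced energy density along the sides `N(k+1)`. [cite: KomaTasaki1994, §1] -/
theorem tendsto_groundEnergy_dWaveSourceTorusTT'_div_sq_mul (t' U μ h : ℝ) :
    Tendsto (fun k : ℕ => (dWaveSourceTorusTT' (N * (k + 1)) t' U μ h).groundEnergy /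
      (((N * (k + 1) : ℕ) : ℝ)) ^ 2) atTop (𝓝 (dWaveSourceEnergyDensityTT' t' U μ h)) := by
  haveI : ∀ k : ℕ, NeZero (N * (k + 1)) := fun k => ⟨mul_ne_zero (NeZero.ne N) (Nat.succ_ne_zero k)⟩
  have hN : 0 < N := Nat.pos_of_ne_zero (NeZero.ne N)
  have h0 := (tendsto_dWaveSourceEnergyDensityTT' t' U μ h).comp (tendsto_mul_succ_sub_one N)
  refine h0.congr fun k => ?_
  rw [Function.comp_apply]
  exact groundEnergy_sourced_div_sq_congr (mul_succ_sub_one_add_one N hN k) t' U μ h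

/-- **T8 THERMODYNAMIC LIMIT along the trivial-holonomy sides** (rational twist `κ_i = χ_N(a_i)`, i.e.
`q = 4πa/N`): the energy densities of the T8 objects `dWaveSourceTorusTT'Twist (N(k+1)) t' U μ h (a·(k+1))`
CONVERGE as `k → ∞`, to the all-sides limit of the uniformly twisted tori. [cite: Watanabe2019, §2.2.1]
[cite: BratteliKishimotoRobinson1978, Thm. 2] -/
theorem exists_tendsto_groundEnergy_dWaveSourceTorusTT'Twist_div_sq (a : Fin 2 → ℕ) (t' U μ h : ℝ) :
    ∃ e : ℝ,
      Tendsto (fun L : ℕ => (dWaveSourceTorusTT'TwistU1 (L + 1) t' U μ h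
          (fun i => ZMod.toCircle ((a i : ℕ) : ZMod N))).groundEnergy / (((L + 1 : ℕ) : ℝ)) ^ 2) atTop (𝓝 e) ∧
      Tendsto (fun k : ℕ => (dWaveSourceTorusTT'Twist (N * (k + 1)) t' U μ h
          (fun i => ((a i * (k + 1) : ℕ) : ZMod (N * (k + 1))))).groundEnergy / (((N * (k + 1) : ℕ) : ℝ)) ^ 2)
        atTop (𝓝 e) := by
  haveI : ∀ k : ℕ, NeZero (N * (k + 1)) := fun k => ⟨mul_ne_zero (NeZero.ne N) (Nat.succ_ne_zero k)⟩
  have hN : 0 < N := Nat.pos_of_ne_zero (NeZero.ne N)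
  obtain ⟨e, he, -, -⟩ := exists_tendsto_groundEnergy_dWaveSourceTorusTT'TwistU1_div_sq t' U μ h
    (fun i => ZMod.toCircle ((a i : ℕ) : ZMod N))
  refine ⟨e, he, ?_⟩
  obtain ⟨L₀, hL₀⟩ := dWaveSourceTorusTT'TwistU1_eq_twist_rational N a t' U μ h
  have hcomp := he.comp (tendsto_mul_succ_sub_one N)
  refine hcomp.congr' ?_
  have hev : ∀ᶠ k : ℕ in atTop, L₀ ≤ N * (k + 1) := by
    refine eventually_atTop.2 ⟨L₀, fun k hk => ?_⟩
    have : k + 1 ≤ N * (k + 1) := Nat.le_mul_of_pos_left _ hN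
    omega
  filter_upwards [hev] with k hk
  rw [Function.comp_apply, groundEnergy_twistU1_div_sq_congr (mul_succ_sub_one_add_one N hN k), hL₀ (k + 1) hk]

/-- **THE SOURCED HELICITY CHORD DENSITY HAS A THERMODYNAMIC LIMIT** along the trivial-holonomy sides,
and it lies in `[?, e_src(0) − e_src(h)]`: for a rational twist `q = 4πa/N`,
`ΔE_L(h,q)/L² = (E₀(dWaveSourceTorusTT'Twist L … (a·L/N)) − E₀(A_L(h)))/L²` converges along `L = N(k+1)`
to some `c ≤ e_src(0) − e_src(h)` (the finite-volume chord bound `sourcedHelicityChord_le_sourcedGain` in the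
limit). So the T8 word «`X ≤ ΔE(h,q)/L² ≤ Y`» reads on a thermodynamic-limit quantity.
[cite: KomaTasaki1994, §1] [cite: Watanabe2019, §2.2.1] -/
theorem exists_tendsto_sourcedHelicityChord_div_sq (a : Fin 2 → ℕ) (t' U μ h : ℝ) :
    ∃ c : ℝ, c ≤ dWaveSourceEnergyDensityTT' t' U μ 0 - dWaveSourceEnergyDensityTT' t' U μ h ∧
      Tendsto (fun k : ℕ => ((dWaveSourceTorusTT'Twist (N * (k + 1)) t' U μ h
          (fun i => ((a i * (k + 1) : ℕ) : ZMod (N * (k + 1))))).groundEnergy -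
          (dWaveSourceTorusTT' (N * (k + 1)) t' U μ h).groundEnergy) / (((N * (k + 1) : ℕ) : ℝ)) ^ 2)
        atTop (𝓝 c) := by
  haveI : ∀ k : ℕ, NeZero (N * (k + 1)) := fun k => ⟨mul_ne_zero (NeZero.ne N) (Nat.succ_ne_zero k)⟩
  have hN : 0 < N := Nat.pos_of_ne_zero (NeZero.ne N)
  obtain ⟨e, -, he⟩ := exists_tendsto_groundEnergy_dWaveSourceTorusTT'Twist_div_sq N a t' U μ h
  have hsrc := tendsto_groundEnergy_dWaveSourceTorusTT'_div_sq_mul N t' U μ h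
  have hsrc0 := tendsto_groundEnergy_dWaveSourceTorusTT'_div_sq_mul N t' U μ 0
  have hchord : Tendsto (fun k : ℕ => ((dWaveSourceTorusTT'Twist (N * (k + 1)) t' U μ h
        (fun i => ((a i * (k + 1) : ℕ) : ZMod (N * (k + 1))))).groundEnergy -
        (dWaveSourceTorusTT' (N * (k + 1)) t' U μ h).groundEnergy) / (((N * (k + 1) : ℕ) : ℝ)) ^ 2)
      atTop (𝓝 (e - dWaveSourceEnergyDensityTT' t' U μ h)) := by
    refine (he.sub hsrc).congr fun k => ?_
    rw [sub_div]
  have hgain : Tendsto (fun k : ℕ => ((dWaveSourceTorusTT' (N * (k + 1)) t' U μ 0).groundEnergy -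
        (dWaveSourceTorusTT' (N * (k + 1)) t' U μ h).groundEnergy) / (((N * (k + 1) : ℕ) : ℝ)) ^ 2)
      atTop (𝓝 (dWaveSourceEnergyDensityTT' t' U μ 0 - dWaveSourceEnergyDensityTT' t' U μ h)) := by
    refine (hsrc0.sub hsrc).congr fun k => ?_
    rw [sub_div]
  refine ⟨e - dWaveSourceEnergyDensityTT' t' U μ h, ?_, hchord⟩
  refine le_of_tendsto_of_tendsto hchord hgain ?_
  refine eventually_atTop.2 ⟨2, fun k hk => ?_⟩
  have hL3 : 3 ≤ N * (k + 1) := by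
    have : k + 1 ≤ N * (k + 1) := Nat.le_mul_of_pos_left _ hN
    omega
  have hpos : (0 : ℝ) < (((N * (k + 1) : ℕ) : ℝ)) ^ 2 := by positivity
  exact div_le_div_of_nonneg_right (sourcedHelicityChord_le_sourcedGain (N * (k + 1)) hL3 t' U μ h _) hpos.le

end Sequel

end Literature.MathematicalPhysics.QuantumLattice

end
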